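import Summits.BirchSwinnertonDyer.Rank1Residual.Additive.KobayashiTowerPoints
import Summits.BirchSwinnertonDyer.Rank1Residual.Additive.KobayashiLayerLogDescent
import Mathlib.NumberTheory.DirichletCharacter.GaussSum
import HarnessLib

/-!
# Route `ThetaPartnerAtTwo` (TP2), crux K3 `SignedKatoDivisibilityUpToAtTwo` (stmt-BirchSwinnertonDyer-20308 / K3P′ 25631), line
# `colemanrat` v12 — (R3) CORE: the CHARACTER SUMS OF THE LOGARITHMS OF THE TOWER POINTS are Gauss sums (Kobayashi Prop. 8.26, any `p`)

Lead prover `bsd-wall-tp2-p2x` g6 (cell `bsd-wall`). HONEST FRAMING: theorems only (no definition, no named fact, no instance, no `sorry`);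
closes no item; K3 / K3P′ are NOT settled and BSD is NOT proved by any of this.

## What is here

The endgame architecture of the K3 PUB residue (memo `Cruxes/SignedKatoDivisibilityUpToAtTwo/G6-LEAD-v11.md` v3) reads the finite-level
explicit reciprocity law «`ν·P_{n,d_n}(z_n) ≡ μ·θ_n (mod ω_n)`» character by character (Kobayashi 2003, proof of Thm. 6.3, p. 25):
`ψ(P_{n,d_n}(z)) = [Σ_σ ψ(σ)·log_Ê(σ d_n)]·[Σ_σ ψ̄(σ)·exp*_ω(σ z)]`. The second factor is Kato's value law (tree: cite-only fact
`Kato2004.exists_eulerSystem_expStar_values`); the first is Kobayashi's **Prop. 8.26** — the character sums of the logarithms of the Honda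
points are Gauss sums. The tree's tower points `c_m` have logarithms `ℓ_m = ell p m = Σ_{k<m} (−1)^k (ζ_{m−2k} − 1)/p^k`
(`Rank1Residual/Additive/KobayashiTowerPoints`, `ptLogΩ(c_m) = ell p m`; at `p = 2`: `SignedKatoOffTwo.LocalTwo.plusPointsLayer_two`), and a Galois
conjugate `σ_a` (`σ_a ζ = ζ^a`) sends `ℓ_m` to the TWISTED sum `ℓ_m^{(a)} = Σ_{k<m} (−1)^k (ζ_{m−2k}^a − 1)/p^k`. This file proves, for every
prime `p`, every `m ≥ 1` and every PRIMITIVE Dirichlet character `ψ` modulo `p^m` with values in `ℚ̄_p`: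

  `Σ_{a mod p^m} ψ(a) · ℓ_m^{(a)} = τ(ψ, ζ_m) := Σ_a ψ(a) ζ_m^a`   (`sum_mul_twistedEll_eq_gaussSum`)

— only the `k = 0` term survives: for `k ≥ 1`, `ζ_{m−2k} = ζ_m^{p^{2k}}` and `Σ_a ψ(a) ζ_m^{p^{2k}a} = ψ̄(p^{2k})·τ(ψ) = 0` (`p^{2k}` is not a unit
mod `p^m`; Mathlib `gaussSum_mulShift_of_isPrimitive`), and `Σ_a ψ(a) = 0`. This is the cyclotomic heart of Kobayashi's Prop. 8.26 (there with the
`p^{−[n/2]}`-normalised points `c_n^±`; here for the un-normalised `ℓ_m`, all `p`, incl. `p = 2`), stated WITHOUT the Galois action (the twist is the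
exponent `a`), so that the (R3) seat only has to supply `σ • ell p m = ℓ_m^{(χ_cyc(σ))}` and the additivity/equivariance of `ptLogΩ`.

References: [Kobayashi2003] S. Kobayashi, Invent. Math. 152 (2003), §8.4 (the points `c_n`, Lemma 8.9), Prop. 8.26 (p. 25); [Washington1997]
L. Washington, GTM 83, Lemma 4.7–4.8 (Gauss sums of primitive characters).
-/

set_option autoImplicit false
-- the Theorems namespace of this sub repeats the summit name by design (D-0017 nested layout)
set_option linter.dupNamespace false

noncomputable section

open scoped Classical

open Finset DirichletCharacter
  Summit.BirchSwinnertonDyer.Rank1Residual.Additive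
  Summit.BirchSwinnertonDyer.Rank1Residual.Additive.PadicCyclotomicTower
  Summit.BirchSwinnertonDyer.Rank1Residual.Additive.BallEval

namespace Summit.BirchSwinnertonDyer.BirchSwinnertonDyer.Theorems.SignedKatoOffTwo.HondaLog

variable {p : ℕ} [hp : Fact p.Prime]

/-- `ζ_m^{p^m} = 1`. [folklore] -/
theorem zeta_pow_prime_pow_self (m : ℕ) : zeta p m ^ p ^ m = 1 :=
  (isPrimitiveRoot_zeta p m).pow_eq_one

/-- `ζ_{m−2k}^{a} = ζ_m^{((p^{2k} : ZMod p^m) · a).val}` for `a ∈ ℤ/p^m` — the twist exponent read through the additive character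
`x ↦ ζ_m^x` shifted by `p^{2k}`. [folklore] -/
theorem zeta_sub_pow_val_eq (m k : ℕ) (a : ZMod (p ^ m)) :
    zeta p (m - 2 * k) ^ a.val = zeta p m ^ (((p ^ (2 * k) : ℕ) : ZMod (p ^ m)) * a).val := by
  haveI : NeZero (p ^ m) := ⟨pow_ne_zero m hp.out.ne_zero⟩
  have hζ : zeta p (m - 2 * k) = zeta p m ^ p ^ (2 * k) := (zeta_pow_sq_pow (p := p) m k).symm
  rw [hζ, ← pow_mul, pow_eq_pow_mod (p ^ (2 * k) * a.val) (zeta_pow_prime_pow_self m), ZMod.val_mul, ZMod.val_natCast,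
    Nat.mod_mul_mod]

/-- For `k ≥ 1` and `m ≥ 1`, `p^{2k}` is NOT a unit modulo `p^m`. [folklore] -/
theorem not_isUnit_prime_pow_cast {m k : ℕ} (hm : 1 ≤ m) (hk : 1 ≤ k) :
    ¬ IsUnit (((p ^ (2 * k) : ℕ) : ZMod (p ^ m))) := by
  haveI : NeZero (p ^ m) := ⟨pow_ne_zero m hp.out.ne_zero⟩
  intro hu
  have hcop := (ZMod.isUnit_iff_coprime (p ^ (2 * k)) (p ^ m)).mp hu
  have h1 : p ∣ p ^ (2 * k) := dvd_pow_self p (by omega)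
  have h2 : p ∣ p ^ m := dvd_pow_self p (by omega)
  have h3 : p ∣ Nat.gcd (p ^ (2 * k)) (p ^ m) := Nat.dvd_gcd h1 h2
  rw [hcop] at h3
  exact hp.out.one_lt.ne' (Nat.dvd_one.mp h3)

/-- A primitive character modulo `p^m`, `m ≥ 1`, is non-trivial. [folklore] -/
theorem ne_one_of_isPrimitive {m : ℕ} (hm : 1 ≤ m) [NeZero (p ^ m)] {ψ : DirichletCharacter (PadicAlgCl p) (p ^ m)}
    (hψ : ψ.IsPrimitive) : ψ ≠ 1 := by
  intro h
  rw [h, isPrimitive_def, conductor_one] at hψ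
  have : 1 < p ^ m := Nat.one_lt_pow (by omega) hp.out.one_lt
  omega

/-- **The character sums of the twisted logarithms are Gauss sums** (Kobayashi Prop. 8.26, un-normalised, any `p`): for `m ≥ 1` and a
PRIMITIVE Dirichlet character `ψ` modulo `p^m` with values in `ℚ̄_p`,
`Σ_{a mod p^m} ψ(a)·(Σ_{k<m} (−1)^k (ζ_{m−2k}^a − 1)/p^k) = Σ_a ψ(a) ζ_m^a` (the Gauss sum of `ψ` against `x ↦ ζ_m^x`).
[cite: Kobayashi2003, Prop. 8.26 (p. 25)] [cite: Washington1997, Lemma 4.7–4.8] -/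
theorem sum_mul_twistedEll_eq_gaussSum {m : ℕ} (hm : 1 ≤ m) [NeZero (p ^ m)]
    (ψ : DirichletCharacter (PadicAlgCl p) (p ^ m)) (hψ : ψ.IsPrimitive) :
    ∑ a : ZMod (p ^ m), ψ a * ∑ k ∈ range m, (-1 : PadicAlgCl p) ^ k * (zeta p (m - 2 * k) ^ a.val - 1) / (p : PadicAlgCl p) ^ k =
      gaussSum ψ (AddChar.zmodChar (p ^ m) (zeta_pow_prime_pow_self (p := p) m)) := by
  set e : AddChar (ZMod (p ^ m)) (PadicAlgCl p) := AddChar.zmodChar (p ^ m) (zeta_pow_prime_pow_self (p := p) m) with he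
  -- the Gauss sum at the shift `p^{2k}`
  have hG : ∀ k : ℕ, ∑ a : ZMod (p ^ m), ψ a * zeta p (m - 2 * k) ^ a.val =
      gaussSum ψ (e.mulShift (((p ^ (2 * k) : ℕ) : ZMod (p ^ m)))) := by
    intro k
    rw [gaussSum]
    refine Finset.sum_congr rfl fun a _ ↦ ?_
    rw [AddChar.mulShift_apply, he, AddChar.zmodChar_apply, zeta_sub_pow_val_eq]
  -- it vanishes for `k ≥ 1` and is `τ(ψ)` for `k = 0`
  have hG0 : ∑ a : ZMod (p ^ m), ψ a * zeta p (m - 2 * 0) ^ a.val = gaussSum ψ e := by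
    rw [hG 0, mul_zero, pow_zero, Nat.cast_one, AddChar.mulShift_one]
  have hGk : ∀ k : ℕ, 1 ≤ k → ∑ a : ZMod (p ^ m), ψ a * zeta p (m - 2 * k) ^ a.val = 0 := by
    intro k hk
    rw [hG k, gaussSum_mulShift_of_isPrimitive _ hψ, MulChar.map_nonunit _ (not_isUnit_prime_pow_cast hm hk), zero_mul]
  -- `Σ_a ψ(a) = 0`
  have hψ0 : ∑ a : ZMod (p ^ m), ψ a = 0 := MulChar.sum_eq_zero_of_ne_one (ne_one_of_isPrimitive hm hψ)
  -- swap the sums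
  have hinner : ∀ k : ℕ, ∑ a : ZMod (p ^ m),
      ψ a * ((-1 : PadicAlgCl p) ^ k * (zeta p (m - 2 * k) ^ a.val - 1) / (p : PadicAlgCl p) ^ k) =
      (-1 : PadicAlgCl p) ^ k / (p : PadicAlgCl p) ^ k *
        ((∑ a : ZMod (p ^ m), ψ a * zeta p (m - 2 * k) ^ a.val) - ∑ a : ZMod (p ^ m), ψ a) := by
    intro k
    rw [mul_sub, Finset.mul_sum, Finset.mul_sum, ← Finset.sum_sub_distrib]
    refine Finset.sum_congr rfl fun a _ ↦ ?_
    ring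
  calc ∑ a : ZMod (p ^ m), ψ a * ∑ k ∈ range m,
        (-1 : PadicAlgCl p) ^ k * (zeta p (m - 2 * k) ^ a.val - 1) / (p : PadicAlgCl p) ^ k
      = ∑ a : ZMod (p ^ m), ∑ k ∈ range m,
          ψ a * ((-1 : PadicAlgCl p) ^ k * (zeta p (m - 2 * k) ^ a.val - 1) / (p : PadicAlgCl p) ^ k) := by
        refine Finset.sum_congr rfl fun a _ ↦ ?_
        rw [Finset.mul_sum]
    _ = ∑ k ∈ range m, ∑ a : ZMod (p ^ m),
          ψ a * ((-1 : PadicAlgCl p) ^ k * (zeta p (m - 2 * k) ^ a.val - 1) / (p : PadicAlgCl p) ^ k) :=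
        Finset.sum_comm
    _ = ∑ k ∈ range m, (-1 : PadicAlgCl p) ^ k / (p : PadicAlgCl p) ^ k *
          ((∑ a : ZMod (p ^ m), ψ a * zeta p (m - 2 * k) ^ a.val) - ∑ a : ZMod (p ^ m), ψ a) :=
        Finset.sum_congr rfl fun k _ ↦ hinner k
    _ = (-1 : PadicAlgCl p) ^ 0 / (p : PadicAlgCl p) ^ 0 *
          ((∑ a : ZMod (p ^ m), ψ a * zeta p (m - 2 * 0) ^ a.val) - ∑ a : ZMod (p ^ m), ψ a) := by
        refine Finset.sum_eq_single 0 (fun k hk hk0 ↦ ?_) (fun h ↦ ?_)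
        · rw [hGk k (Nat.one_le_iff_ne_zero.mpr hk0), hψ0, sub_zero, mul_zero]
        · exact absurd (Finset.mem_range.mpr (by omega)) h
    _ = gaussSum ψ e := by
        rw [hG0, hψ0, sub_zero, pow_zero, pow_zero, div_one, one_mul]

/-! ## The Galois twist of `ℓ_m` -/

/-- **A Galois conjugate of `ζ_m` is a power `ζ_m^a`, `(a, p) = 1`** (the cyclotomic character modulo `p^m`). [folklore] -/
theorem exists_smul_zeta_eq_pow (σ : Field.absoluteGaloisGroup ℚ_[p]) (m : ℕ) :
    ∃ a : ℕ, a < p ^ m ∧ a.Coprime (p ^ m) ∧ σ • zeta p m = zeta p m ^ a := by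
  haveI : NeZero (p ^ m) := ⟨pow_ne_zero m hp.out.ne_zero⟩
  have hζ := isPrimitiveRoot_zeta p m
  have hpow : (σ • zeta p m) ^ p ^ m = 1 := by rw [← smul_pow', hζ.pow_eq_one, smul_one]
  obtain ⟨a, ha, heq⟩ := hζ.eq_pow_of_pow_eq_one hpow
  refine ⟨a, ha, ?_, heq.symm⟩
  -- `σ • ζ_m` is again a primitive `p^m`-th root, so `a` is prime to `p^m`
  have hprim : IsPrimitiveRoot (σ • zeta p m) (p ^ m) := by
    rw [Field.absoluteGaloisGroup.smul_def]
    exact hζ.map_of_injective (Field.absoluteGaloisGroup.toAlgEquiv ℚ_[p] σ).injective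
  rw [← heq] at hprim
  exact (hζ.pow_iff_coprime (pow_pos hp.out.pos m) a).mp hprim

/-- **The Galois twist of the tower logarithm**: if `σ ζ_m = ζ_m^a` then
`σ • ℓ_m = Σ_{k<m} (−1)^k (ζ_{m−2k}^a − 1)/p^k` (`σ ζ_{m−2k} = σ ζ_m^{p^{2k}} = ζ_{m−2k}^a`; `σ` is a `ℚ_p`-algebra automorphism).
With the additivity and Galois-equivariance of the formal logarithm this is `log_Ê(σ c_m)` for the tower point `c_m` (`ptLogΩ(c_m) = ℓ_m`).
[cite: Kobayashi2003, §8.4 (Lemma 8.9) and Prop. 8.26 (p. 25)] -/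
theorem smul_ell_eq_twistedEll (σ : Field.absoluteGaloisGroup ℚ_[p]) (m : ℕ) {a : ℕ}
    (ha : σ • zeta p m = zeta p m ^ a) :
    σ • ell p m = ∑ k ∈ range m, (-1 : PadicAlgCl p) ^ k * (zeta p (m - 2 * k) ^ a - 1) / (p : PadicAlgCl p) ^ k := by
  have hζk : ∀ k : ℕ, σ • zeta p (m - 2 * k) = zeta p (m - 2 * k) ^ a := by
    intro k
    rw [← zeta_pow_sq_pow (p := p) m k, smul_pow', ha, ← pow_mul, ← pow_mul, mul_comm]
  rw [ell, Field.absoluteGaloisGroup.smul_def, map_sum]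
  refine Finset.sum_congr rfl fun k _ ↦ ?_
  have hk := hζk k
  rw [Field.absoluteGaloisGroup.smul_def] at hk
  rw [map_div₀, map_mul, map_pow, map_pow, map_neg, map_one, map_sub, map_one, map_natCast, hk]

/-! ## §2 The plus combination `3(ℓ_m + σ_m ℓ_m) − 2ℓ_1` (the logarithm of the plus Honda point `d_{m−2}` at `p = 2`) -/

/-- For `j ≥ 1` and `m ≥ 1`, `p^j` is not a unit modulo `p^m`. [folklore] -/
theorem not_isUnit_prime_pow_cast' {m j : ℕ} (hm : 1 ≤ m) (hj : 1 ≤ j) :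
    ¬ IsUnit (((p ^ j : ℕ) : ZMod (p ^ m))) := by
  haveI : NeZero (p ^ m) := ⟨pow_ne_zero m hp.out.ne_zero⟩
  intro hu
  have hcop := (ZMod.isUnit_iff_coprime (p ^ j) (p ^ m)).mp hu
  have h3 : p ∣ Nat.gcd (p ^ j) (p ^ m) := Nat.dvd_gcd (dvd_pow_self p (by omega)) (dvd_pow_self p (by omega))
  rw [hcop] at h3
  exact hp.out.one_lt.ne' (Nat.dvd_one.mp h3)

/-- **The twist by an inverter composed with `τ_a` is the twist by `−a`**: if `σ ζ_m = ζ_m⁻¹` and `τ ζ_m = ζ_m^{a}` (`a ∈ ℤ/p^m`), then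
`(τσ) • ℓ_m = Σ_{k<m} (−1)^k (ζ_{m−2k}^{(−a)} − 1)/p^k`. [cite: Kobayashi2003, §8.4 and Prop. 8.26] -/
theorem mul_inverter_smul_ell_eq_twistedEll {m : ℕ} [NeZero (p ^ m)] {σ τ : Field.absoluteGaloisGroup ℚ_[p]}
    (hσ : σ • zeta p m = (zeta p m)⁻¹) {a : ZMod (p ^ m)} (hτ : τ • zeta p m = zeta p m ^ a.val) :
    (τ * σ) • ell p m = ∑ k ∈ range m, (-1 : PadicAlgCl p) ^ k * (zeta p (m - 2 * k) ^ (-a).val - 1) / (p : PadicAlgCl p) ^ k := by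
  refine smul_ell_eq_twistedEll (τ * σ) m ?_
  have e_neg : zeta p m ^ (-a).val = (zeta p m ^ a.val)⁻¹ := by
    have h := AddChar.map_neg_eq_inv (AddChar.zmodChar (p ^ m) (zeta_pow_prime_pow_self (p := p) m)) a
    rwa [AddChar.zmodChar_apply, AddChar.zmodChar_apply] at h
  rw [mul_smul, hσ, smul_inv'', hτ, e_neg]

/-- **Reindexing by `a ↦ −a`**: `Σ_a ψ(a)·ℓ_m^{(−a)} = ψ(−1)·τ(ψ)` for a primitive `ψ` modulo `p^m`, `m ≥ 1`.
[cite: Kobayashi2003, Prop. 8.26 (p. 25)] -/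
theorem sum_mul_twistedEll_neg_eq {m : ℕ} (hm : 1 ≤ m) [NeZero (p ^ m)]
    (ψ : DirichletCharacter (PadicAlgCl p) (p ^ m)) (hψ : ψ.IsPrimitive) :
    ∑ a : ZMod (p ^ m), ψ a * ∑ k ∈ range m, (-1 : PadicAlgCl p) ^ k * (zeta p (m - 2 * k) ^ (-a).val - 1) / (p : PadicAlgCl p) ^ k =
      ψ (-1) * gaussSum ψ (AddChar.zmodChar (p ^ m) (zeta_pow_prime_pow_self (p := p) m)) := by
  rw [← sum_mul_twistedEll_eq_gaussSum hm ψ hψ, Finset.mul_sum]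
  conv_rhs => rw [← Equiv.sum_comp (Equiv.neg (ZMod (p ^ m)))]
  refine Finset.sum_congr rfl fun a _ ↦ ?_
  rw [Equiv.neg_apply, ← mul_assoc, ← map_mul, neg_one_mul, neg_neg]

/-- **The character sum of the plus logarithm** (shape of the logarithm of the plus Honda point at `2`, `d_n = 3•(c_m + σ_m•c_m) − 2•c_1`,
`m = n + 2`, `log c_m = ℓ_m`): for `m ≥ 2` and a primitive `ψ` modulo `p^m`,
`Σ_a ψ(a)·(3(ℓ_m^{(a)} + ℓ_m^{(−a)}) − 2 ℓ_1^{(a)}) = 3(1 + ψ(−1))·τ(ψ)` — the `ℓ_1`-term dies because `ζ_1^{a} = ζ_m^{p^{m−1}a}` is an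
imprimitive shift. For EVEN `ψ` this is `6τ(ψ)`; for odd `ψ` it is `0` (the plus points only see even characters).
[cite: Kobayashi2003, Prop. 8.26 (p. 25)] -/
theorem sum_mul_plusLog_eq {m : ℕ} (hm : 2 ≤ m) [NeZero (p ^ m)]
    (ψ : DirichletCharacter (PadicAlgCl p) (p ^ m)) (hψ : ψ.IsPrimitive) :
    ∑ a : ZMod (p ^ m), ψ a *
        (3 * ((∑ k ∈ range m, (-1 : PadicAlgCl p) ^ k * (zeta p (m - 2 * k) ^ a.val - 1) / (p : PadicAlgCl p) ^ k) +
              ∑ k ∈ range m, (-1 : PadicAlgCl p) ^ k * (zeta p (m - 2 * k) ^ (-a).val - 1) / (p : PadicAlgCl p) ^ k) -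
          2 * (zeta p 1 ^ a.val - 1)) =
      3 * (1 + ψ (-1)) * gaussSum ψ (AddChar.zmodChar (p ^ m) (zeta_pow_prime_pow_self (p := p) m)) := by
  set e : AddChar (ZMod (p ^ m)) (PadicAlgCl p) := AddChar.zmodChar (p ^ m) (zeta_pow_prime_pow_self (p := p) m) with he
  have hm1 : 1 ≤ m := by omega
  -- the `ℓ_1`-term: `Σ_a ψ(a) ζ_1^a = τ(ψ, shift p^{m−1}) = 0`, `Σ_a ψ(a) = 0`
  have hζ1 : ∀ a : ZMod (p ^ m), zeta p 1 ^ a.val = e ((((p ^ (m - 1) : ℕ) : ZMod (p ^ m))) * a) := by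
    intro a
    rw [he, AddChar.zmodChar_apply]
    have h1 : zeta p 1 = zeta p m ^ p ^ (m - 1) := by
      conv_lhs => rw [show 1 = (m - (m - 1)) by omega]
      rw [← zeta_add_pow p (m - (m - 1)) (m - 1), show m - (m - 1) + (m - 1) = m by omega]
    rw [h1, ← pow_mul, pow_eq_pow_mod (p ^ (m - 1) * a.val) (zeta_pow_prime_pow_self m), ZMod.val_mul,
      ZMod.val_natCast, Nat.mod_mul_mod]
  have hsum1 : ∑ a : ZMod (p ^ m), ψ a * (zeta p 1 ^ a.val - 1) = 0 := by
    have hA : ∑ a : ZMod (p ^ m), ψ a * zeta p 1 ^ a.val = 0 := by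
      have hG : ∑ a : ZMod (p ^ m), ψ a * zeta p 1 ^ a.val = gaussSum ψ (e.mulShift (((p ^ (m - 1) : ℕ) : ZMod (p ^ m)))) := by
        rw [gaussSum]
        exact Finset.sum_congr rfl fun a _ ↦ by rw [AddChar.mulShift_apply, hζ1]
      rw [hG, gaussSum_mulShift_of_isPrimitive _ hψ, MulChar.map_nonunit _ (not_isUnit_prime_pow_cast' hm1 (by omega)),
        zero_mul]
    have hB : ∑ a : ZMod (p ^ m), ψ a = 0 := MulChar.sum_eq_zero_of_ne_one (ne_one_of_isPrimitive hm1 hψ)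
    calc ∑ a : ZMod (p ^ m), ψ a * (zeta p 1 ^ a.val - 1)
        = (∑ a : ZMod (p ^ m), ψ a * zeta p 1 ^ a.val) - ∑ a : ZMod (p ^ m), ψ a := by
          rw [← Finset.sum_sub_distrib]; exact Finset.sum_congr rfl fun a _ ↦ by ring
      _ = 0 := by rw [hA, hB, sub_zero]
  have hplus := sum_mul_twistedEll_eq_gaussSum hm1 ψ hψ
  have hminus := sum_mul_twistedEll_neg_eq hm1 ψ hψ
  -- linear combination of the three sums
  have hsplit : ∑ a : ZMod (p ^ m), ψ a *
        (3 * ((∑ k ∈ range m, (-1 : PadicAlgCl p) ^ k * (zeta p (m - 2 * k) ^ a.val - 1) / (p : PadicAlgCl p) ^ k) +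
              ∑ k ∈ range m, (-1 : PadicAlgCl p) ^ k * (zeta p (m - 2 * k) ^ (-a).val - 1) / (p : PadicAlgCl p) ^ k) -
          2 * (zeta p 1 ^ a.val - 1)) =
      3 * (∑ a : ZMod (p ^ m), ψ a * ∑ k ∈ range m, (-1 : PadicAlgCl p) ^ k * (zeta p (m - 2 * k) ^ a.val - 1) / (p : PadicAlgCl p) ^ k) +
        3 * (∑ a : ZMod (p ^ m), ψ a * ∑ k ∈ range m, (-1 : PadicAlgCl p) ^ k * (zeta p (m - 2 * k) ^ (-a).val - 1) / (p : PadicAlgCl p) ^ k) -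
        2 * ∑ a : ZMod (p ^ m), ψ a * (zeta p 1 ^ a.val - 1) := by
    rw [Finset.mul_sum, Finset.mul_sum, Finset.mul_sum, ← Finset.sum_add_distrib, ← Finset.sum_sub_distrib]
    exact Finset.sum_congr rfl fun a _ ↦ by ring
  rw [hsplit, hplus, hminus, hsum1, mul_zero, sub_zero]
  ring

/-! ## §3 The logarithm of the Galois conjugates of the plus point `D = 3•(c + σ•c) − 2•c₁` and its character sums -/

section PlusPoint

open WeierstrassCurve Field Literature.NumberTheory.EllipticCurves Literature.NumberTheory.EllipticCurves.FormalGroupChart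
  Literature.NumberTheory.GaloisRepresentations

variable {M : WeierstrassCurve ℤ_[p]} [hE : (M.map PadicInt.Coe.ringHom).IsElliptic]
  [hintΩ : (genFibΩ p M).IsIntegral (Valued.v (R := PadicAlgCl p)).integer]

/-- **The logarithm of a Galois conjugate of the plus point.** For an abstract Galois action `act` on the `Ω`-points of the model
(coordinatewise, as in `BallEval.ptLogΩ_act`), tower points `c ∈ L(m) ∩ E₁` with `Λ(c) = ℓ_m` and `c₁ ∈ L(1) ∩ E₁` with `Λ(c₁) = ℓ_1`,
and any `σ, τ ∈ Γ_{ℚ_p}`: `Λ(act τ (3•(c + act σ c) − 2•c₁)) = τ • (3(ℓ_m + σ•ℓ_m) − 2ℓ_1)`. (At `p = 2`, `σ` an inverter of `ζ_{2^m}`,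
this is the logarithm of the conjugates of the K3/K4 plus Honda point `d_{m−2}`.) [cite: Kobayashi2003, §8.4 (Lemma 8.9), Prop. 8.26]
[cite: SilvermanAEC2009, IV.6.4] -/
theorem ptLogΩ_act_plusPoint
    (act : Field.absoluteGaloisGroup ℚ_[p] → (genFibΩ p M).toAffine.Point → (genFibΩ p M).toAffine.Point)
    (hact0 : ∀ σ, act σ 0 = 0)
    (hact : ∀ σ (x y : PadicAlgCl p) (h : (genFibΩ p M).toAffine.Nonsingular x y),
      ∃ h', act σ (Affine.Point.some x y h) = Affine.Point.some (σ • x) (σ • y) h')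
    (σ τ : Field.absoluteGaloisGroup ℚ_[p]) {m : ℕ} (hm : 1 ≤ m) {c c₁ : (genFibΩ p M).toAffine.Point}
    (hcL : c ∈ subfieldPoints (genFibΩ p M) (layer p m).toSubfield coeffs_mem_layer)
    (hck : c ∈ kernel (Valued.v (R := PadicAlgCl p)) (genFibΩ p M)) (hcℓ : ptLogΩ p M c = ell p m)
    (hc₁L : c₁ ∈ subfieldPoints (genFibΩ p M) (layer p 1).toSubfield coeffs_mem_layer)
    (hc₁k : c₁ ∈ kernel (Valued.v (R := PadicAlgCl p)) (genFibΩ p M)) (hc₁ℓ : ptLogΩ p M c₁ = ell p 1) :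
    ptLogΩ p M (act τ ((3 : ℕ) • (c + act σ c) - (2 : ℕ) • c₁)) =
      τ • (3 * (ell p m + σ • ell p m) - 2 * ell p 1) := by
  haveI := isIntegral_curveK p (LayerField p m) M
  have hσcL : act σ c ∈ subfieldPoints (genFibΩ p M) (layer p m).toSubfield coeffs_mem_layer :=
    act_mem_subfieldPoints act hact0 hact σ hcL
  have hσck : act σ c ∈ kernel (Valued.v (R := PadicAlgCl p)) (genFibΩ p M) := act_mem_kernel act hact0 hact σ hck
  have hc₁L' : c₁ ∈ subfieldPoints (genFibΩ p M) (layer p m).toSubfield coeffs_mem_layer :=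
    subfieldPoints_layer_mono hm hc₁L
  have hsumL : c + act σ c ∈ subfieldPoints (genFibΩ p M) (layer p m).toSubfield coeffs_mem_layer :=
    (subfieldPoints _ _ _).add_mem hcL hσcL
  have hsumk : c + act σ c ∈ kernel (Valued.v (R := PadicAlgCl p)) (genFibΩ p M) :=
    (kernel (Valued.v (R := PadicAlgCl p)) (genFibΩ p M)).add_mem hck hσck
  have h3L : (3 : ℕ) • (c + act σ c) ∈ subfieldPoints (genFibΩ p M) (layer p m).toSubfield coeffs_mem_layer :=
    (subfieldPoints _ _ _).nsmul_mem hsumL 3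
  have h3k : (3 : ℕ) • (c + act σ c) ∈ kernel (Valued.v (R := PadicAlgCl p)) (genFibΩ p M) :=
    (kernel (Valued.v (R := PadicAlgCl p)) (genFibΩ p M)).nsmul_mem hsumk 3
  have h2L : (2 : ℕ) • c₁ ∈ subfieldPoints (genFibΩ p M) (layer p m).toSubfield coeffs_mem_layer :=
    (subfieldPoints _ _ _).nsmul_mem hc₁L' 2
  have h2k : (2 : ℕ) • c₁ ∈ kernel (Valued.v (R := PadicAlgCl p)) (genFibΩ p M) :=
    (kernel (Valued.v (R := PadicAlgCl p)) (genFibΩ p M)).nsmul_mem hc₁k 2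
  have hDk : (3 : ℕ) • (c + act σ c) - (2 : ℕ) • c₁ ∈ kernel (Valued.v (R := PadicAlgCl p)) (genFibΩ p M) :=
    (kernel (Valued.v (R := PadicAlgCl p)) (genFibΩ p M)).sub_mem h3k h2k
  rw [ptLogΩ_act act hact0 hact τ (norm_zCoord_lt_one_of_mem_kernel hDk),
    ptLogΩ_sub (m := m) h3L h2L h3k h2k, ptLogΩ_nsmul (m := m) hsumL hsumk, ptLogΩ_nsmul (m := m) hc₁L' hc₁k,
    ptLogΩ_add (m := m) hcL hσcL hck hσck, ptLogΩ_act act hact0 hact σ (norm_zCoord_lt_one_of_mem_kernel hck), hcℓ, hc₁ℓ]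
  push_cast
  ring_nf

/-- **The Galois conjugate of the plus logarithm in twisted form**: for `σ` an inverter of `ζ_m` and `τ` with `τ ζ_m = ζ_m^a`
(`a ∈ ℤ/p^m`, `m ≥ 1`): `τ • (3(ℓ_m + σ•ℓ_m) − 2ℓ_1) = 3(ℓ_m^{(a)} + ℓ_m^{(−a)}) − 2(ζ_1^a − 1)`. [cite: Kobayashi2003, Prop. 8.26] -/
theorem smul_plusLog_eq_twisted {m : ℕ} (hm : 1 ≤ m) [NeZero (p ^ m)] {σ τ : Field.absoluteGaloisGroup ℚ_[p]}
    (hσ : σ • zeta p m = (zeta p m)⁻¹) {a : ZMod (p ^ m)} (hτ : τ • zeta p m = zeta p m ^ a.val) :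
    τ • (3 * (ell p m + σ • ell p m) - 2 * ell p 1) =
      3 * ((∑ k ∈ range m, (-1 : PadicAlgCl p) ^ k * (zeta p (m - 2 * k) ^ a.val - 1) / (p : PadicAlgCl p) ^ k) +
            ∑ k ∈ range m, (-1 : PadicAlgCl p) ^ k * (zeta p (m - 2 * k) ^ (-a).val - 1) / (p : PadicAlgCl p) ^ k) -
        2 * (zeta p 1 ^ a.val - 1) := by
  have h1 : τ • ell p m = ∑ k ∈ range m, (-1 : PadicAlgCl p) ^ k * (zeta p (m - 2 * k) ^ a.val - 1) / (p : PadicAlgCl p) ^ k :=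
    smul_ell_eq_twistedEll τ m hτ
  have h2 : τ • (σ • ell p m) =
      ∑ k ∈ range m, (-1 : PadicAlgCl p) ^ k * (zeta p (m - 2 * k) ^ (-a).val - 1) / (p : PadicAlgCl p) ^ k := by
    rw [← mul_smul]; exact mul_inverter_smul_ell_eq_twistedEll hσ hτ
  have hτ1 : τ • zeta p 1 = zeta p 1 ^ a.val := by
    have e1 : zeta p 1 = zeta p m ^ p ^ (m - 1) := by
      conv_lhs => rw [show 1 = (m - (m - 1)) by omega]
      rw [← zeta_add_pow p (m - (m - 1)) (m - 1), show m - (m - 1) + (m - 1) = m by omega]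
    rw [e1, smul_pow', hτ, ← pow_mul, ← pow_mul, mul_comm]
  have h3 : τ • ell p 1 = zeta p 1 ^ a.val - 1 := by
    rw [smul_ell_eq_twistedEll τ 1 hτ1, Finset.sum_range_one]
    simp
  rw [Field.absoluteGaloisGroup.smul_def] at h1 h2 h3 ⊢
  rw [map_sub, map_mul, map_mul, map_add, map_ofNat, map_ofNat, h1, h2, h3]

/-- **The character sum of the logarithms of the Galois orbit of the plus point** (Kobayashi Prop. 8.26 for the un-normalised plus
points, any `p`, `m ≥ 2`): with `act`, `c`, `c₁`, `σ` (an inverter of `ζ_m`) as above and ANY family `τ_a ∈ Γ_{ℚ_p}` with `τ_a ζ_m = ζ_m^a`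
for the units `a` (arbitrary for non-units), for every primitive Dirichlet character `ψ` modulo `p^m`:
`Σ_a ψ(a) · Λ(act τ_a (3•(c + act σ c) − 2•c₁)) = 3(1 + ψ(−1))·τ(ψ)`. [cite: Kobayashi2003, Prop. 8.26 (p. 25)] -/
theorem sum_mul_ptLogΩ_act_plusPoint_eq
    (act : Field.absoluteGaloisGroup ℚ_[p] → (genFibΩ p M).toAffine.Point → (genFibΩ p M).toAffine.Point)
    (hact0 : ∀ σ, act σ 0 = 0)
    (hact : ∀ σ (x y : PadicAlgCl p) (h : (genFibΩ p M).toAffine.Nonsingular x y),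
      ∃ h', act σ (Affine.Point.some x y h) = Affine.Point.some (σ • x) (σ • y) h')
    {m : ℕ} (hm : 2 ≤ m) [NeZero (p ^ m)] {σ : Field.absoluteGaloisGroup ℚ_[p]} (hσ : σ • zeta p m = (zeta p m)⁻¹)
    (τ : ZMod (p ^ m) → Field.absoluteGaloisGroup ℚ_[p]) (hτ : ∀ a : ZMod (p ^ m), IsUnit a → τ a • zeta p m = zeta p m ^ a.val)
    {c c₁ : (genFibΩ p M).toAffine.Point}
    (hcL : c ∈ subfieldPoints (genFibΩ p M) (layer p m).toSubfield coeffs_mem_layer)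
    (hck : c ∈ kernel (Valued.v (R := PadicAlgCl p)) (genFibΩ p M)) (hcℓ : ptLogΩ p M c = ell p m)
    (hc₁L : c₁ ∈ subfieldPoints (genFibΩ p M) (layer p 1).toSubfield coeffs_mem_layer)
    (hc₁k : c₁ ∈ kernel (Valued.v (R := PadicAlgCl p)) (genFibΩ p M)) (hc₁ℓ : ptLogΩ p M c₁ = ell p 1)
    (ψ : DirichletCharacter (PadicAlgCl p) (p ^ m)) (hψ : ψ.IsPrimitive) :
    ∑ a : ZMod (p ^ m), ψ a * ptLogΩ p M (act (τ a) ((3 : ℕ) • (c + act σ c) - (2 : ℕ) • c₁)) =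
      3 * (1 + ψ (-1)) * gaussSum ψ (AddChar.zmodChar (p ^ m) (zeta_pow_prime_pow_self (p := p) m)) := by
  rw [← sum_mul_plusLog_eq hm ψ hψ]
  refine Finset.sum_congr rfl fun a _ ↦ ?_
  by_cases ha : IsUnit a
  · rw [ptLogΩ_act_plusPoint act hact0 hact σ (τ a) (by omega) hcL hck hcℓ hc₁L hc₁k hc₁ℓ,
      smul_plusLog_eq_twisted (by omega) hσ (hτ a ha)]
  · rw [MulChar.map_nonunit ψ ha, zero_mul, zero_mul]

end PlusPoint

/-! ## §4 Kobayashi's factorisation (Prop. 8.25): `Σ_τ ψ(τ)·Tr(τx · E) = (Σ_τ ψ(τ) τx)·(Σ_ρ ψ(ρ)⁻¹ ρE)` -/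

section Factorisation

variable {G R : Type*} [Group G] [Fintype G] [CommRing R] [MulSemiringAction G R]

/-- **The character sum of a trace pairing factorises** (the algebra of Kobayashi's Prop. 8.25,
`P_{n,x}(z) = (Σ_σ log x^σ σ)(Σ_σ exp*(z^σ) σ⁻¹)`): for a finite group `G` acting on a commutative ring `R` by ring automorphisms, a
multiplicative `ψ : G → R` and `x, E ∈ R` (`Tr(y) = Σ_ρ ρ•y`): `Σ_τ ψ(τ)·Tr((τ•x)·E) = (Σ_τ ψ(τ)·τ•x)·(Σ_ρ ψ(ρ⁻¹)·ρ•E)`. With `x = log_Ê(d_n)`,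
`E = exp*_ω(z_n)` and Bloch–Kato `(x, z)_n = Tr(log x · exp* z)`: `ψ(P_{n,d_n}(z))` = (log character sum, §3) × (exp* character sum, Kato's
value law) — the bridge to the Mazur–Tate value of the K3 stub. [cite: Kobayashi2003, Prop. 8.25 (p. 24)] -/
theorem sum_mul_trace_smul_mul_eq (ψ : G →* R) (x E : R) :
    ∑ τ : G, ψ τ * ∑ ρ : G, ρ • (τ • x * E) = (∑ τ : G, ψ τ * τ • x) * ∑ ρ : G, ψ ρ⁻¹ * ρ • E := by
  calc ∑ τ : G, ψ τ * ∑ ρ : G, ρ • (τ • x * E)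
      = ∑ τ : G, ∑ ρ : G, ψ τ * ((ρ * τ) • x * ρ • E) := by
        refine Finset.sum_congr rfl fun τ _ ↦ ?_
        rw [Finset.mul_sum]
        refine Finset.sum_congr rfl fun ρ _ ↦ ?_
        rw [smul_mul', mul_smul]
    _ = ∑ ρ : G, ∑ τ : G, ψ τ * ((ρ * τ) • x * ρ • E) := Finset.sum_comm
    _ = ∑ ρ : G, ∑ τ : G, ψ (ρ⁻¹ * τ) * (τ • x * ρ • E) := by
        refine Finset.sum_congr rfl fun ρ _ ↦ ?_
        rw [← Equiv.sum_comp (Equiv.mulLeft ρ⁻¹)]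
        refine Finset.sum_congr rfl fun τ _ ↦ ?_
        rw [Equiv.coe_mulLeft, mul_inv_cancel_left]
    _ = ∑ ρ : G, ψ ρ⁻¹ * ρ • E * ∑ τ : G, ψ τ * τ • x := by
        refine Finset.sum_congr rfl fun ρ _ ↦ ?_
        rw [Finset.mul_sum]
        refine Finset.sum_congr rfl fun τ _ ↦ ?_
        rw [map_mul]
        ring
    _ = (∑ τ : G, ψ τ * τ • x) * ∑ ρ : G, ψ ρ⁻¹ * ρ • E := by
        rw [← Finset.sum_mul, mul_comm]

end Factorisation

end Summit.BirchSwinnertonDyer.BirchSwinnertonDyer.Theorems.SignedKatoOffTwo.HondaLog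

end
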